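import Mathlib
import Literature.Analysis.Convex.SecondOrderConePrograms
import HarnessLib

/-!
# Balls in halfspaces: the Chebyshev-center LP and robust linear programming as an SOCP
(Boyd–Vandenberghe, *Convex Optimization*, §4.3.1 (4.30)–(4.31), §4.4.2 (4.37), §8.5.1 (8.16))

Source: S. Boyd, L. Vandenberghe, *Convex Optimization*, Cambridge University Press (2004)
[cite: BoydVandenberghe2004] — open copy read: §4.3.1 "Chebyshev center of a polyhedron"
(pp. 148–149: the ball `B = {x_c + u | ‖u‖₂ ≤ r}` lies in the halfspace `aᵀx ≤ b` iff
`aᵀx_c + r‖a‖₂ ≤ b`, (4.30)–(4.31), because `sup{aᵀu | ‖u‖₂ ≤ r} = r‖a‖₂`; hence `B ⊆ P` for the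
polyhedron `P = {x | aᵢᵀx ≤ bᵢ}` iff (4.31) holds for every `i`, and the Chebyshev center is found
by the LP `maximize r s.t. aᵢᵀx_c + r‖aᵢ‖₂ ≤ bᵢ`), §8.5.1 "Chebyshev center" (pp. 416–418: the
depth `depth(x, C) = dist(x, ℝⁿ ∖ C)` of a point, a Chebyshev center as a point of maximum depth
= the center of the largest inscribed ball, and the polyhedral case in a general norm, where the
constraint function is `gᵢ(x, R) = aᵢᵀx + R‖aᵢ‖_* − bᵢ` with the dual norm), and §4.4.2 "Robust
linear programming" (p. 157: with ellipsoidal uncertainty `aᵢ ∈ ℰᵢ = {āᵢ + Pᵢu | ‖u‖₂ ≤ 1}` the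
robust constraint `aᵢᵀx ≤ bᵢ ∀ aᵢ ∈ ℰᵢ` is `sup{aᵢᵀx | aᵢ ∈ ℰᵢ} = āᵢᵀx + ‖Pᵢᵀx‖₂ ≤ bᵢ`, a
second-order cone constraint, so the robust LP (4.37) is an SOCP).

## Setting

* The general-norm statements (§8.5.1) are over a real normed space `E` with the coefficient
  vector `a` replaced by a continuous functional `φ : E →L[ℝ] ℝ` and `‖a‖_*` by the operator norm
  `‖φ‖`; the Euclidean statements (§4.3.1, §4.4.2) are over a real inner product space `V` with
  `aᵀx = ⟪a, x⟫`, and follow from the general ones through `innerSL` (`‖innerSL ℝ a‖ = ‖a‖`).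
* `Pᵢᵀ` is the adjoint `ContinuousLinearMap.adjoint Pᵢ` (`V` complete, e.g. finite-dimensional).
* The depth is Mathlib's `Metric.infDist x Cᶜ`; statements comparing radii with the depth assume
  `Cᶜ` nonempty (for `C = univ` Mathlib's `infDist x ∅ = 0` is a junk value), which is the book's
  standing assumption "`C` bounded".

## Relation to the tree

`Literature/Analysis/Convex/SecondOrderConePrograms.lean` (imported) defines the second-order cone
`soc V = {(t, u) | ‖u‖ ≤ t}` and the LP ⊂ QP ⊂ SOCP reductions of Antoniou–Lu §14.7; the robust
constraint is expressed as membership in that cone (`robustConstraint_iff_mem_soc`).  Chebyshev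
*approximation* files of the tree (`Analysis/Approximation/…`) concern a different problem.  Nothing
in the tree treats balls inscribed in polyhedra, the depth function or robust linear constraints.
-/

namespace Literature.Analysis.Convex.RobustLinearConstraints

open Set Metric
open scoped InnerProductSpace RealInnerProductSpace

noncomputable section

/-! ## The supremum of a linear functional over a ball (general norm: the dual norm) -/

section DualNorm

variable {E : Type*} [NormedAddCommGroup E] [NormedSpace ℝ E]

/-- `aᵀu ≤ r‖a‖_*` for `‖u‖ ≤ r`: the easy half of `sup{aᵀu | ‖u‖ ≤ r} = r‖a‖_*`.
[cite: BoydVandenberghe2004, §8.5.1] -/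
theorem apply_le_mul_opNorm_of_norm_le (φ : E →L[ℝ] ℝ) {u : E} {r : ℝ} (hu : ‖u‖ ≤ r) :
    φ u ≤ r * ‖φ‖ := by
  have h1 : φ u ≤ ‖φ u‖ := by rw [Real.norm_eq_abs]; exact le_abs_self _
  have h2 : ‖φ u‖ ≤ ‖φ‖ * ‖u‖ := φ.le_opNorm u
  have h3 : ‖φ‖ * ‖u‖ ≤ ‖φ‖ * r := mul_le_mul_of_nonneg_left hu (norm_nonneg _)
  linarith

/-- The supremum `r‖a‖_*` is approached: for `r ≥ 0` and `ε > 0` some `u` with `‖u‖ ≤ r` has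
`aᵀu > r‖a‖_* − ε`. [cite: BoydVandenberghe2004, §8.5.1] -/
theorem exists_norm_le_lt_apply (φ : E →L[ℝ] ℝ) {r ε : ℝ} (hr : 0 ≤ r) (hε : 0 < ε) :
    ∃ u : E, ‖u‖ ≤ r ∧ r * ‖φ‖ - ε < φ u := by
  rcases hr.eq_or_lt with rfl | hr'
  · exact ⟨0, by simp, by simp [hε]⟩
  · have hlt : ‖φ‖ - ε / r < ‖φ‖ := by
      have := div_pos hε hr'
      linarith
    obtain ⟨x, hx1, hx2⟩ := φ.exists_lt_apply_of_lt_opNorm hlt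
    -- choose the sign of `x` so that `φ` is nonnegative on it
    obtain ⟨y, hy1, hy2⟩ : ∃ y : E, ‖y‖ < 1 ∧ ‖φ‖ - ε / r < φ y := by
      by_cases hs : 0 ≤ φ x
      · refine ⟨x, hx1, ?_⟩
        rwa [Real.norm_eq_abs, abs_of_nonneg hs] at hx2
      · push Not at hs
        refine ⟨-x, by rwa [norm_neg], ?_⟩
        rw [Real.norm_eq_abs, abs_of_neg hs] at hx2
        rwa [map_neg]
    refine ⟨r • y, ?_, ?_⟩
    · rw [norm_smul, Real.norm_eq_abs, abs_of_pos hr']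
      nlinarith
    · rw [map_smul, smul_eq_mul]
      have : r * (‖φ‖ - ε / r) = r * ‖φ‖ - ε := by
        field_simp
      nlinarith [mul_lt_mul_of_pos_left hy2 hr']

/-- A ball lies in a halfspace if the center satisfies the tightened inequality:
`aᵀx_c + r‖a‖_* ≤ b ⟹ B(x_c, r) ⊆ {x | aᵀx ≤ b}` ((4.30) ⇐ (4.31), any norm).
[cite: BoydVandenberghe2004, §4.3.1 (4.30)–(4.31)] -/
theorem closedBall_subset_halfspace_of_le (φ : E →L[ℝ] ℝ) {xc : E} {r b : ℝ}
    (h : φ xc + r * ‖φ‖ ≤ b) : closedBall xc r ⊆ {x | φ x ≤ b} := by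
  intro x hx
  rw [mem_closedBall, dist_eq_norm] at hx
  have h1 := apply_le_mul_opNorm_of_norm_le φ hx
  rw [map_sub] at h1
  show φ x ≤ b
  linarith

/-- **Ball in a halfspace** (general norm, dual norm on the coefficient vector): for `r ≥ 0`,
`B(x_c, r) ⊆ {x | aᵀx ≤ b}` iff `aᵀx_c + r‖a‖_* ≤ b` — (4.30) ⟺ (4.31), and the formula
`gᵢ(x, R) = aᵢᵀx + R‖aᵢ‖_* − bᵢ` of §8.5.1. [cite: BoydVandenberghe2004, §8.5.1 (8.16)] -/
theorem closedBall_subset_halfspace_iff (φ : E →L[ℝ] ℝ) {xc : E} {r b : ℝ} (hr : 0 ≤ r) :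
    closedBall xc r ⊆ {x | φ x ≤ b} ↔ φ xc + r * ‖φ‖ ≤ b := by
  refine ⟨fun h => ?_, closedBall_subset_halfspace_of_le φ⟩
  by_contra hlt
  push Not at hlt
  obtain ⟨u, hu, hφu⟩ := exists_norm_le_lt_apply φ hr (by linarith : 0 < φ xc + r * ‖φ‖ - b)
  have hmem : xc + u ∈ closedBall xc r := by
    rw [mem_closedBall, dist_eq_norm, add_sub_cancel_left]
    exact hu
  have := h hmem
  simp only [mem_setOf_eq, map_add] at this
  linarith

end DualNorm

/-! ## The Euclidean case: `sup{aᵀu | ‖u‖₂ ≤ r} = r‖a‖₂` and (4.31) -/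

section Euclidean

variable {V : Type*} [NormedAddCommGroup V] [InnerProductSpace ℝ V]

/-- Cauchy–Schwarz form of the bound: `⟪a, u⟫ ≤ r‖a‖` when `‖u‖ ≤ r`.
[cite: BoydVandenberghe2004, §4.3.1 (4.30)] -/
theorem inner_le_mul_norm_of_norm_le (a : V) {u : V} {r : ℝ} (hu : ‖u‖ ≤ r) :
    ⟪a, u⟫ ≤ r * ‖a‖ := by
  have h1 : ⟪a, u⟫ ≤ ‖a‖ * ‖u‖ := real_inner_le_norm a u
  have h2 : ‖a‖ * ‖u‖ ≤ ‖a‖ * r := mul_le_mul_of_nonneg_left hu (norm_nonneg _)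
  linarith

/-- The supremum is attained at `u = (r/‖a‖) a`: `sup{aᵀu | ‖u‖₂ ≤ r} = r‖a‖₂` for `r ≥ 0`,
stated as: `r‖a‖` is the greatest element of `{⟪a, u⟫ | ‖u‖ ≤ r}`.
[cite: BoydVandenberghe2004, §4.3.1 (4.30)] -/
theorem isGreatest_inner_closedBall (a : V) {r : ℝ} (hr : 0 ≤ r) :
    IsGreatest ((fun u => ⟪a, u⟫) '' closedBall (0 : V) r) (r * ‖a‖) := by
  refine ⟨?_, ?_⟩
  · by_cases ha : a = 0
    · refine ⟨0, by simp [hr], by simp [ha]⟩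
    · have hna : 0 < ‖a‖ := norm_pos_iff.mpr ha
      refine ⟨(r / ‖a‖) • a, ?_, ?_⟩
      · rw [mem_closedBall, dist_zero_right, norm_smul, Real.norm_eq_abs,
          abs_of_nonneg (div_nonneg hr hna.le), div_mul_cancel₀ _ hna.ne']
      · simp only [real_inner_smul_right, real_inner_self_eq_norm_sq]
        field_simp
  · rintro _ ⟨u, hu, rfl⟩
    rw [mem_closedBall, dist_zero_right] at hu
    exact inner_le_mul_norm_of_norm_le a hu

/-- `sup{aᵀu | ‖u‖₂ ≤ r} = r‖a‖₂` (`r ≥ 0`) as an equation for the real supremum.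
[cite: BoydVandenberghe2004, §4.3.1 (4.30)] -/
theorem sSup_inner_closedBall (a : V) {r : ℝ} (hr : 0 ≤ r) :
    sSup ((fun u => ⟪a, u⟫) '' closedBall (0 : V) r) = r * ‖a‖ :=
  (isGreatest_inner_closedBall a hr).csSup_eq

/-- **(4.31)**: for `r ≥ 0`, the Euclidean ball `B(x_c, r)` lies in the halfspace `aᵀx ≤ b` iff
`aᵀx_c + r‖a‖₂ ≤ b` — a linear inequality in `(x_c, r)`.
[cite: BoydVandenberghe2004, §4.3.1 (4.31)] -/
theorem closedBall_subset_inner_halfspace_iff (a xc : V) {r b : ℝ} (hr : 0 ≤ r) :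
    closedBall xc r ⊆ {x | ⟪a, x⟫ ≤ b} ↔ ⟪a, xc⟫ + r * ‖a‖ ≤ b := by
  have h := closedBall_subset_halfspace_iff (innerSL ℝ a) (xc := xc) (b := b) hr
  simp only [innerSL_apply_apply, innerSL_apply_norm] at h
  exact h

/-! ## §4.3.1 / §8.5.1 The Chebyshev center of a polyhedron -/

variable {ι : Type*}

/-- The polyhedron `P = {x | aᵢᵀx ≤ bᵢ, i ∈ ι}`. [cite: BoydVandenberghe2004, §4.3.1] -/
def polyhedron (a : ι → V) (b : ι → ℝ) : Set V := {x | ∀ i, ⟪a i, x⟫ ≤ b i}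

/-- [cite: BoydVandenberghe2004, §4.3.1] -/
theorem mem_polyhedron_iff {a : ι → V} {b : ι → ℝ} {x : V} :
    x ∈ polyhedron a b ↔ ∀ i, ⟪a i, x⟫ ≤ b i := Iff.rfl

/-- A polyhedron is closed. [cite: BoydVandenberghe2004, §4.3.1] -/
theorem isClosed_polyhedron (a : ι → V) (b : ι → ℝ) : IsClosed (polyhedron a b) := by
  have : polyhedron a b = ⋂ i, {x | ⟪a i, x⟫ ≤ b i} := by
    ext x; simp [polyhedron]
  rw [this]
  exact isClosed_iInter fun i => isClosed_le (continuous_const.inner continuous_id) continuous_const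

/-- A polyhedron is convex. [cite: BoydVandenberghe2004, §4.3.1] -/
theorem convex_polyhedron (a : ι → V) (b : ι → ℝ) : Convex ℝ (polyhedron a b) := by
  intro x hx y hy s t hs ht hst i
  have h1 := mul_le_mul_of_nonneg_left (hx i) hs
  have h2 := mul_le_mul_of_nonneg_left (hy i) ht
  have h3 : s * b i + t * b i = b i := by rw [← add_mul, hst, one_mul]
  simp only [inner_add_right, real_inner_smul_right]
  linarith

/-- "`B ⊆ P` if and only if (4.31) holds for all `i`": for `r ≥ 0`, `B(x_c, r) ⊆ P` iff
`aᵢᵀx_c + r‖aᵢ‖₂ ≤ bᵢ` for every `i`. [cite: BoydVandenberghe2004, §4.3.1 (4.31)] -/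
theorem closedBall_subset_polyhedron_iff (a : ι → V) (b : ι → ℝ) (xc : V) {r : ℝ} (hr : 0 ≤ r) :
    closedBall xc r ⊆ polyhedron a b ↔ ∀ i, ⟪a i, xc⟫ + r * ‖a i‖ ≤ b i := by
  simp only [← closedBall_subset_inner_halfspace_iff _ _ hr, polyhedron, subset_def, mem_setOf_eq]
  exact ⟨fun h i x hx => h x hx i, fun h x hx i => h i x hx⟩

/-- Feasibility for the **Chebyshev-center LP** `maximize r s.t. aᵢᵀx_c + r‖aᵢ‖₂ ≤ bᵢ` (with the
implicit `r ≥ 0` of the ball representation made explicit, as in the §8.5.1 form `R ≥ 0`).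
[cite: BoydVandenberghe2004, §4.3.1] -/
def ChebyshevFeasible (a : ι → V) (b : ι → ℝ) (xc : V) (r : ℝ) : Prop :=
  0 ≤ r ∧ ∀ i, ⟪a i, xc⟫ + r * ‖a i‖ ≤ b i

/-- The LP constraints say exactly that the ball of radius `r ≥ 0` around `x_c` lies in `P`.
[cite: BoydVandenberghe2004, §4.3.1 (4.31)] -/
theorem chebyshevFeasible_iff (a : ι → V) (b : ι → ℝ) (xc : V) (r : ℝ) :
    ChebyshevFeasible a b xc r ↔ 0 ≤ r ∧ closedBall xc r ⊆ polyhedron a b := by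
  constructor
  · rintro ⟨hr, h⟩
    exact ⟨hr, (closedBall_subset_polyhedron_iff a b xc hr).mpr h⟩
  · rintro ⟨hr, h⟩
    exact ⟨hr, (closedBall_subset_polyhedron_iff a b xc hr).mp h⟩

/-- A feasible center lies in the polyhedron. [cite: BoydVandenberghe2004, §4.3.1] -/
theorem ChebyshevFeasible.mem {a : ι → V} {b : ι → ℝ} {xc : V} {r : ℝ}
    (h : ChebyshevFeasible a b xc r) : xc ∈ polyhedron a b :=
  ((chebyshevFeasible_iff a b xc r).mp h).2 (mem_closedBall_self h.1)

end Euclidean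

/-! ## §8.5.1 Depth and Chebyshev centers (any metric space) -/

section Depth

variable {α : Type*} [PseudoMetricSpace α]

/-- The **depth** of `x` in `C`: `depth(x, C) = dist(x, ℝⁿ ∖ C)`.
[cite: BoydVandenberghe2004, §8.5.1] -/
def depth (C : Set α) (x : α) : ℝ := infDist x Cᶜ

/-- [cite: BoydVandenberghe2004, §8.5.1] -/
theorem depth_eq (C : Set α) (x : α) : depth C x = infDist x Cᶜ := rfl

/-- [cite: BoydVandenberghe2004, §8.5.1] -/
theorem depth_nonneg (C : Set α) (x : α) : 0 ≤ depth C x := infDist_nonneg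

/-- "The depth gives the radius of the largest ball, centered at `x`, that lies in `C`", first
half: the open ball of radius `depth(x, C)` lies in `C`. [cite: BoydVandenberghe2004, §8.5.1] -/
theorem ball_depth_subset (C : Set α) (x : α) : ball x (depth C x) ⊆ C :=
  ball_infDist_compl_subset

/-- … hence every closed ball of radius `< depth(x, C)` lies in `C`.
[cite: BoydVandenberghe2004, §8.5.1] -/
theorem closedBall_subset_of_lt_depth {C : Set α} {x : α} {r : ℝ} (h : r < depth C x) :
    closedBall x r ⊆ C :=
  (closedBall_subset_ball h).trans (ball_depth_subset C x)

/-- Second half: a ball around `x` inside `C` has radius at most `depth(x, C)` (for `C ≠ univ`).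
[cite: BoydVandenberghe2004, §8.5.1] -/
theorem le_depth_of_closedBall_subset {C : Set α} {x : α} {r : ℝ} (hC : Cᶜ.Nonempty)
    (h : closedBall x r ⊆ C) : r ≤ depth C x := by
  by_contra hlt
  push Not at hlt
  obtain ⟨y, hyC, hy⟩ := (infDist_lt_iff hC).mp hlt
  have hyB : y ∈ closedBall x r := by
    rw [mem_closedBall, dist_comm]
    exact hy.le
  exact hyC (h hyB)

/-- A **Chebyshev center** of `C`: a point of `C` of maximum depth.
[cite: BoydVandenberghe2004, §8.5.1] -/
def IsChebyshevCenter (C : Set α) (x : α) : Prop := x ∈ C ∧ ∀ y ∈ C, depth C y ≤ depth C x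

end Depth

section DepthNormed

variable {V : Type*} [NormedAddCommGroup V] [NormedSpace ℝ V]

/-- In a normed space, for closed `C ∋ x` the closed ball of radius `depth(x, C)` itself lies in
`C` ("the largest ball, centered at `x`, that lies in `C`"). [cite: BoydVandenberghe2004, §8.5.1] -/
theorem closedBall_depth_subset {C : Set V} (hC : IsClosed C) {x : V} (hx : x ∈ C) {r : ℝ}
    (hr : r ≤ depth C x) : closedBall x r ⊆ C := by
  rcases lt_trichotomy r 0 with h | rfl | h
  · rw [closedBall_eq_empty.mpr h]
    exact empty_subset _
  · rw [closedBall_zero]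
    exact singleton_subset_iff.mpr hx
  · rw [← closure_ball x h.ne']
    exact (closure_mono ((ball_subset_ball hr).trans (ball_depth_subset C x))).trans
      hC.closure_subset

end DepthNormed

/-! ## The Chebyshev-center LP solves the maximum-depth problem -/

section ChebyshevLP

variable {V : Type*} [NormedAddCommGroup V] [InnerProductSpace ℝ V] {ι : Type*}
  {a : ι → V} {b : ι → ℝ}

/-- A feasible radius is a lower bound for the depth of its center (`P ≠ univ`).
[cite: BoydVandenberghe2004, §8.5.1] -/
theorem ChebyshevFeasible.le_depth {xc : V} {r : ℝ} (hP : (polyhedron a b)ᶜ.Nonempty)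
    (h : ChebyshevFeasible a b xc r) : r ≤ depth (polyhedron a b) xc :=
  le_depth_of_closedBall_subset hP ((chebyshevFeasible_iff a b xc r).mp h).2

/-- Every point of `P` with its depth is feasible for the LP (the polyhedron is closed).
[cite: BoydVandenberghe2004, §8.5.1] -/
theorem chebyshevFeasible_depth {x : V} (hx : x ∈ polyhedron a b) :
    ChebyshevFeasible a b x (depth (polyhedron a b) x) :=
  (chebyshevFeasible_iff a b x _).mpr
    ⟨depth_nonneg _ _, closedBall_depth_subset (isClosed_polyhedron a b) hx le_rfl⟩

/-- "Hence the Chebyshev center can be determined by solving the LP": if `(x_c, r)` is optimal for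
`maximize r s.t. aᵢᵀx_c + r‖aᵢ‖₂ ≤ bᵢ, r ≥ 0`, then `r = depth(x_c, P)` is the maximum depth and
`x_c` is a Chebyshev center of `P` (`P ≠ univ`). [cite: BoydVandenberghe2004, §4.3.1] -/
theorem isChebyshevCenter_of_isOptimal {xc : V} {r : ℝ} (hP : (polyhedron a b)ᶜ.Nonempty)
    (hfeas : ChebyshevFeasible a b xc r)
    (hopt : ∀ x r', ChebyshevFeasible a b x r' → r' ≤ r) :
    depth (polyhedron a b) xc = r ∧ IsChebyshevCenter (polyhedron a b) xc := by
  have h1 : r ≤ depth (polyhedron a b) xc := hfeas.le_depth hP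
  have h2 : depth (polyhedron a b) xc ≤ r := hopt _ _ (chebyshevFeasible_depth hfeas.mem)
  refine ⟨le_antisymm h2 h1, hfeas.mem, fun y hy => ?_⟩
  exact (hopt _ _ (chebyshevFeasible_depth hy)).trans h1

/-- Conversely a Chebyshev center `x⋆` of `P ≠ univ` together with its depth is an optimal point of
the LP. [cite: BoydVandenberghe2004, §8.5.1] -/
theorem IsChebyshevCenter.isOptimal {xs : V} (hP : (polyhedron a b)ᶜ.Nonempty)
    (h : IsChebyshevCenter (polyhedron a b) xs) :
    ChebyshevFeasible a b xs (depth (polyhedron a b) xs) ∧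
      ∀ x r', ChebyshevFeasible a b x r' → r' ≤ depth (polyhedron a b) xs :=
  ⟨chebyshevFeasible_depth h.1, fun _ _ hf => (hf.le_depth hP).trans (h.2 _ hf.mem)⟩

end ChebyshevLP

/-! ## §4.4.2 Robust linear programming with ellipsoidal uncertainty -/

section Robust

variable {V : Type*} [NormedAddCommGroup V] [InnerProductSpace ℝ V]

/-- The uncertainty ellipsoid `ℰ = {ā + P u | ‖u‖₂ ≤ 1}` (`P` may be singular: a "flat"
ellipsoid; `P = 0` means `a = ā` is known exactly). [cite: BoydVandenberghe2004, §4.4.2] -/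
def ellipsoid (abar : V) (P : V →L[ℝ] V) : Set V := {a | ∃ u : V, ‖u‖ ≤ 1 ∧ a = abar + P u}

/-- [cite: BoydVandenberghe2004, §4.4.2] -/
theorem center_mem_ellipsoid (abar : V) (P : V →L[ℝ] V) : abar ∈ ellipsoid abar P :=
  ⟨0, by simp, by simp⟩

variable [CompleteSpace V]

/-- `⟪P u, x⟫ = ⟪Pᵀx, u⟫`. [cite: BoydVandenberghe2004, §4.4.2] -/
theorem inner_apply_eq_inner_adjoint (P : V →L[ℝ] V) (u x : V) :
    ⟪P u, x⟫ = ⟪ContinuousLinearMap.adjoint P x, u⟫ := by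
  rw [ContinuousLinearMap.adjoint_inner_left, real_inner_comm]

/-- `aᵀx ≤ āᵀx + ‖Pᵀx‖₂` for every `a ∈ ℰ` (the bound `uᵀPᵀx ≤ ‖Pᵀx‖₂` for `‖u‖₂ ≤ 1`).
[cite: BoydVandenberghe2004, §4.4.2] -/
theorem inner_le_of_mem_ellipsoid {abar : V} {P : V →L[ℝ] V} {a : V} (ha : a ∈ ellipsoid abar P)
    (x : V) : ⟪a, x⟫ ≤ ⟪abar, x⟫ + ‖ContinuousLinearMap.adjoint P x‖ := by
  obtain ⟨u, hu, rfl⟩ := ha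
  rw [inner_add_left, inner_apply_eq_inner_adjoint]
  have := inner_le_mul_norm_of_norm_le (ContinuousLinearMap.adjoint P x) hu
  linarith

/-- `sup{aᵀx | a ∈ ℰ} = āᵀx + ‖Pᵀx‖₂`: the bound of `inner_le_of_mem_ellipsoid` is attained
(at `u = Pᵀx/‖Pᵀx‖₂`). [cite: BoydVandenberghe2004, §4.4.2] -/
theorem isGreatest_inner_ellipsoid (abar : V) (P : V →L[ℝ] V) (x : V) :
    IsGreatest ((fun a => ⟪a, x⟫) '' ellipsoid abar P)
      (⟪abar, x⟫ + ‖ContinuousLinearMap.adjoint P x‖) := by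
  refine ⟨?_, ?_⟩
  · obtain ⟨u, hu, hval⟩ := (isGreatest_inner_closedBall (ContinuousLinearMap.adjoint P x)
      zero_le_one).1
    rw [mem_closedBall, dist_zero_right] at hu
    refine ⟨abar + P u, ⟨u, hu, rfl⟩, ?_⟩
    simp only at hval ⊢
    rw [inner_add_left, inner_apply_eq_inner_adjoint, hval, one_mul]
  · rintro _ ⟨a, ha, rfl⟩
    exact inner_le_of_mem_ellipsoid ha x

/-- **The robust linear constraint is a second-order cone constraint**:
`(aᵀx ≤ b for all a ∈ ℰ) ⟺ āᵀx + ‖Pᵀx‖₂ ≤ b`. [cite: BoydVandenberghe2004, §4.4.2 (4.37)] -/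
theorem forall_mem_ellipsoid_inner_le_iff (abar : V) (P : V →L[ℝ] V) (x : V) (b : ℝ) :
    (∀ a ∈ ellipsoid abar P, ⟪a, x⟫ ≤ b) ↔ ⟪abar, x⟫ + ‖ContinuousLinearMap.adjoint P x‖ ≤ b := by
  have hg := isGreatest_inner_ellipsoid abar P x
  constructor
  · intro h
    obtain ⟨a, ha, hval⟩ := hg.1
    have := h a ha
    simp only at hval
    linarith
  · intro h a ha
    exact (inner_le_of_mem_ellipsoid ha x).trans h

/-- … i.e. membership of `(b − āᵀx, Pᵀx)` in the second-order cone of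
`SecondOrderConePrograms`. [cite: BoydVandenberghe2004, §4.4.2 (4.37)] -/
theorem robustConstraint_iff_mem_soc (abar : V) (P : V →L[ℝ] V) (x : V) (b : ℝ) :
    (∀ a ∈ ellipsoid abar P, ⟪a, x⟫ ≤ b) ↔
      (b - ⟪abar, x⟫, ContinuousLinearMap.adjoint P x) ∈ SecondOrderConePrograms.soc V := by
  rw [forall_mem_ellipsoid_inner_le_iff, SecondOrderConePrograms.mk_mem_soc_iff]
  constructor <;> intro h <;> linarith

variable {ι : Type*}

/-- **The robust LP (4.37) is an SOCP**: its feasible set `{x | aᵢᵀx ≤ bᵢ ∀ aᵢ ∈ ℰᵢ, i ∈ ι}`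
equals `{x | āᵢᵀx + ‖Pᵢᵀx‖₂ ≤ bᵢ, i ∈ ι}`. [cite: BoydVandenberghe2004, §4.4.2 (4.37)] -/
theorem robustFeasible_eq_socpFeasible (abar : ι → V) (P : ι → V →L[ℝ] V) (b : ι → ℝ) :
    {x : V | ∀ i, ∀ a ∈ ellipsoid (abar i) (P i), ⟪a, x⟫ ≤ b i} =
      {x : V | ∀ i, ⟪abar i, x⟫ + ‖ContinuousLinearMap.adjoint (P i) x‖ ≤ b i} := by
  ext x
  simp only [mem_setOf_eq, forall_mem_ellipsoid_inner_le_iff]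

/-- Hence the robust LP and the SOCP have the same optimal points for any objective `cᵀx`.
[cite: BoydVandenberghe2004, §4.4.2 (4.37)] -/
theorem robustLP_isMinOn_iff (abar : ι → V) (P : ι → V →L[ℝ] V) (b : ι → ℝ) (c x : V) :
    IsMinOn (fun y => ⟪c, y⟫) {y : V | ∀ i, ∀ a ∈ ellipsoid (abar i) (P i), ⟪a, y⟫ ≤ b i} x ↔
      IsMinOn (fun y => ⟪c, y⟫)
        {y : V | ∀ i, ⟪abar i, y⟫ + ‖ContinuousLinearMap.adjoint (P i) y‖ ≤ b i} x := by
  rw [robustFeasible_eq_socpFeasible]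

/-- With no uncertainty (`Pᵢ = 0`) the robust constraint is the nominal one `āᵢᵀx ≤ bᵢ`.
[cite: BoydVandenberghe2004, §4.4.2] -/
theorem forall_mem_ellipsoid_zero_iff (abar x : V) (b : ℝ) :
    (∀ a ∈ ellipsoid abar 0, ⟪a, x⟫ ≤ b) ↔ ⟪abar, x⟫ ≤ b := by
  rw [forall_mem_ellipsoid_inner_le_iff]
  simp

end Robust

end

end Literature.Analysis.Convex.RobustLinearConstraints
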